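import Summits.NavierStokesRegularity.NavierStokesRegularity.Theorems.ScenarioCensusRowF19Top
import Literature.Analysis.FluidPDE.NSVorticityBKMContinuation
import Mathlib.Analysis.ODE.ExistUnique
import HarnessLib

/-!
# Census row F19 family, member F19ob «observer tops / the force floor» — part 1/4: observer fields,
# characteristics, the rows F-obs / F-tw / F-acc / F-force / F1acc, the structural statements, the residual;
# calculus along characteristics

Re-homed for the scenario census (typer seat ns-census-typer-2 g8; lead g7 GO 2026-08-28T17:18Z: PORT of ns-idea-3 LINE 12
«observer-top» REV 2, `pub/ideators/ns-idea-3/lines/observer-top/line-observer-top.lean`, sha16 d9972826d387f45a, 924 l.,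
lean check rc 0, 0 sorry; ref g7 PRE-CHECK ✓ §12.24; critic idea-crit-3 RE-STAMP CONFORMS 16:39:31Z; booked as TREE records of
F19 family MEMBERS under ROW POLICY 15:11Z / cen9 (2), no new row), split for the 400-line rule into
`ScenarioCensusRowF19obTop` (§1–§3: instrument, rows, tools, calculus along characteristics) → `ScenarioCensusRowF19obSchema`
(§4–§5: the schema row F-obs from row F1a BY NAME, instances, structural theorems, residual) → `ScenarioCensusRowF19obSigned`
(§6: signed rows) → `ScenarioCensusRowF19ob` (census keys).  Lean text VERBATIM in namespace `…Theorems.ScenarioCensus.ObserverTop`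
(the line's `…Cruxes.ScenarioCensusRowF1.ObserverTopLine` re-homed); the four real-variable tools identical to LINE 11's
(`deltaStar_pos`, `kappa_mul_lt_one`, `hasDerivAt_inv_sqrt_sub`, `norm_le_barrier`) are taken from the tree's F19 port
(`ScenarioCensus.QuasiSteadyTop`, `ScenarioCensusRowF19Top.lean`) instead of being restated; one bib key corrected
(`Tao2013Localisation`); the `[folklore]` tags of the parameterless row `def`s dropped (gate relocation rule), as in the F19 port.

The schema: an OBSERVER FIELD is any `b : ℝ → ℝ³ → ℝ³`; the `b`-observed rate of change of the velocity is the convective derivative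
`D^b u := ∂ₜu + (b·∇)u` (`timeDerivWithin (Ico 0 T) u t x + convect (b t) (u t) x`); `b` is ADMISSIBLE from time `t₁`
(`HasCharacteristics b t₁ T`) when through every `(t,x)`, `t₁ < t < T`, there is a backward characteristic `X`, `X' = b(s,X)`
on `[t₁,t)`, `X(t) = x`; the solution has a quasi-steady top for `b` with modulus `δ` when `‖D^b u‖ ≤ δ√ν (T−t)^{-3/2}` at all
fast points near `T` (`HasQuasiSteadyTopAlong`).  Rows `Row_Fobs` (schema), `Row_Ftw` (Galilean), `Row_Facc` (Lagrangian,
«ballistic top»), `Row_Fforce` (net force), `Row_F1acc` (Type-I member); structural `ObserverUnsteadiness`, `ForceFloor`;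
residual `TypeIBallisticity`.  §3: joint differentiability of `uncurry u`, the chain rule along characteristics, the Tao-cover
bounds on closed sub-slabs, admissibility of `b ≡ c` and of `b = u` (Picard–Lindelöf).

No census value is asserted here (the lead books the F19 family); NS regularity is NOT proved; `Row_F1` stays open; no summit
statement is proved by this file.
-/

noncomputable section

set_option linter.dupNamespace false

open MeasureTheory Set Function Filter TopologicalSpace Metric
open scoped Topology NNReal ENNReal Laplacian RealInnerProductSpace

namespace Summit.NavierStokesRegularity.NavierStokesRegularity.Theorems.ScenarioCensus.ObserverTop

open Literature.Analysis Literature.Analysis.FluidPDE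
open Summit.NavierStokesRegularity.NavierStokesRegularity.Theorems

/-- `ℝ³`. -/
abbrev E3 := EuclideanSpace ℝ (Fin 3)

/-! ## §1 Observer fields, characteristics, the rows -/

/-- **Backward characteristics of an observer field `b` from time `t₁`**: through every `(t,x)` with
`t₁ < t < T` passes a curve `X`, continuous on `[t₁,t]`, right-differentiable with `X'(s) = b(s,X(s))` on
`[t₁,t)`, ending at `X(t) = x`.  This is a backward-REACHABILITY HYPOTHESIS on the observer `b` (used as
an assumption of the schema rows and discharged in this file for `b ≡ c` and for `b = u`), not a
regularity claim about `b`: the schema says nothing about observers without characteristics. [folklore] -/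
def HasCharacteristics (b : ℝ → E3 → E3) (t₁ T : ℝ) : Prop :=
  ∀ t ∈ Ioo t₁ T, ∀ x : E3, ∃ X : ℝ → E3, X t = x ∧ ContinuousOn X (Icc t₁ t) ∧
    ∀ s ∈ Ico t₁ t, HasDerivWithinAt X (b s (X s)) (Ici s) s

/-- **Quasi-steady top for the observer `b`, modulus `δ`**: at all fast points `Λ < |u(t,x)|`, `t` near
`T`, the `b`-convective derivative `D^b u = ∂ₜu + (b·∇)u` is `δ`-subcritical for the blow-up clock:
`‖D^b u(t,x)‖ ≤ δ√ν/((T−t)√(T−t))`. [folklore] -/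
def HasQuasiSteadyTopAlong (ν T δ : ℝ) (b u : ℝ → E3 → E3) : Prop :=
  ∃ Λ : ℝ, ∀ᶠ t in 𝓝[<] T, ∀ x, Λ < ‖u t x‖ →
    ‖timeDerivWithin (Ico 0 T) u t x + convect (b t) (u t) x‖ ≤
      δ * Real.sqrt ν / ((T - t) * Real.sqrt (T - t))

/-- **Schema row F-obs** (no rate · no symmetry · Clay class · ANY observer field admissible from every
interior time): quasi-steady top for `b` with modulus `0 ≤ δ < 9 − 2√15` ⇒ extension.  PROVED
(`rowFobs_holds`). -/
def Row_Fobs : Prop :=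
  ∀ (ν T δ : ℝ), 0 < ν → 0 < T → 0 ≤ δ → δ < 9 - 2 * Real.sqrt 15 →
    ∀ (b u : ℝ → E3 → E3) (p : ℝ → E3 → ℝ),
    IsClassicalNSSolutionOn (Ico 0 T) ν 0 u p → IsLerayHopfOn T ν 0 (u 0) u →
    HasRapidSpatialDecay (u 0) → (∀ t₁ ∈ Ioo 0 T, HasCharacteristics b t₁ T) →
    HasQuasiSteadyTopAlong ν T δ b u → HasSmoothExtensionPast ν 0 u T

/-- **Row F-tw** (Galilean observers, «travelling-wave top»): for some constant velocity `c`,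
`‖∂ₜu + (c·∇)u‖ ≤ δ√ν(T−t)^{-3/2}` on the top, `0 ≤ δ < 9 − 2√15` ⇒ extension.  PROVED
(`rowFtw_holds`). -/
def Row_Ftw : Prop :=
  ∀ (ν T δ : ℝ), 0 < ν → 0 < T → 0 ≤ δ → δ < 9 - 2 * Real.sqrt 15 →
    ∀ (u : ℝ → E3 → E3) (p : ℝ → E3 → ℝ),
    IsClassicalNSSolutionOn (Ico 0 T) ν 0 u p → IsLerayHopfOn T ν 0 (u 0) u →
    HasRapidSpatialDecay (u 0) → (∃ c : E3, HasQuasiSteadyTopAlong ν T δ (fun _ _ => c) u) →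
    HasSmoothExtensionPast ν 0 u T

/-- **Row F-acc** (the Lagrangian observer, «ballistic top»): the ACCELERATION `∂ₜu + (u·∇)u` of the
fast fluid is `δ`-subcritical, `0 ≤ δ < 9 − 2√15` ⇒ extension.  PROVED (`rowFacc_holds`). -/
def Row_Facc : Prop :=
  ∀ (ν T δ : ℝ), 0 < ν → 0 < T → 0 ≤ δ → δ < 9 - 2 * Real.sqrt 15 →
    ∀ (u : ℝ → E3 → E3) (p : ℝ → E3 → ℝ),
    IsClassicalNSSolutionOn (Ico 0 T) ν 0 u p → IsLerayHopfOn T ν 0 (u 0) u →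
    HasRapidSpatialDecay (u 0) → HasQuasiSteadyTopAlong ν T δ u u → HasSmoothExtensionPast ν 0 u T

/-- **Row F-force** («force-free top»): the net FORCE per mass `νΔu − ∇p` on the fast fluid is
`δ`-subcritical, `‖ν Δu(t,x) − ∇p(t,x)‖ ≤ δ√ν(T−t)^{-3/2}` at fast points near `T`, `0 ≤ δ < 9 − 2√15`
⇒ extension.  PROVED (`rowFforce_holds`). -/
def Row_Fforce : Prop :=
  ∀ (ν T δ : ℝ), 0 < ν → 0 < T → 0 ≤ δ → δ < 9 - 2 * Real.sqrt 15 →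
    ∀ (u : ℝ → E3 → E3) (p : ℝ → E3 → ℝ),
    IsClassicalNSSolutionOn (Ico 0 T) ν 0 u p → IsLerayHopfOn T ν 0 (u 0) u →
    HasRapidSpatialDecay (u 0) →
    (∃ Λ : ℝ, ∀ᶠ t in 𝓝[<] T, ∀ x, Λ < ‖u t x‖ →
      ‖ν • Δ (u t) x - gradient (p t) x‖ ≤ δ * Real.sqrt ν / ((T - t) * Real.sqrt (T - t))) →
    HasSmoothExtensionPast ν 0 u T

/-- **Type-I member F1acc** (frame of `ScenarioCensus.Row_F1` verbatim + ballistic top): PROVED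
(`rowF1acc_holds`). -/
def Row_F1acc : Prop :=
  ∀ (ν T δ : ℝ), 0 < ν → 0 < T → 0 ≤ δ → δ < 9 - 2 * Real.sqrt 15 →
    ∀ (u : ℝ → E3 → E3) (p : ℝ → E3 → ℝ),
    IsClassicalNSSolutionOn (Ico 0 T) ν 0 u p → IsLerayHopfOn T ν 0 (u 0) u →
    HasRapidSpatialDecay (u 0) → IsTypeIBlowup u T → HasQuasiSteadyTopAlong ν T δ u u →
    HasSmoothExtensionPast ν 0 u T

/-- **Structural statement «observer unsteadiness»**: every Clay blow-up (maximal, Leray–Hopf, decaying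
datum; ANY rate), every observer field admissible from every interior time, every `0 ≤ δ < 9 − 2√15`,
every level `Λ`, every `t₁ < T`: some fast point `(t,x)`, `t₁ < t < T`, has `‖D^b u(t,x)‖ > δ√ν(T−t)^{-3/2}`.
PROVED (`observerUnsteadiness_holds`). -/
def ObserverUnsteadiness : Prop :=
  ∀ (ν T : ℝ), 0 < ν → 0 < T →
    ∀ (b u : ℝ → E3 → E3) (p : ℝ → E3 → ℝ),
    IsMaximalSmoothSolution ν 0 u p T → IsLerayHopfOn T ν 0 (u 0) u → HasRapidSpatialDecay (u 0) →
    (∀ t₁ ∈ Ioo 0 T, HasCharacteristics b t₁ T) →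
    ∀ (δ Λ t₁ : ℝ), 0 ≤ δ → δ < 9 - 2 * Real.sqrt 15 → t₁ < T →
      ∃ t ∈ Ioo t₁ T, ∃ x, Λ < ‖u t x‖ ∧
        δ * Real.sqrt ν / ((T - t) * Real.sqrt (T - t)) <
          ‖timeDerivWithin (Ico 0 T) u t x + convect (b t) (u t) x‖

/-- **Structural statement «the force floor»**: at fast points of every Clay blow-up (any rate),
arbitrarily close to `T` and above every speed level, the force per mass exceeds `δ√ν(T−t)^{-3/2}`, for
every `δ < 9 − 2√15`.  PROVED (`forceFloor_holds`). -/
def ForceFloor : Prop :=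
  ∀ (ν T : ℝ), 0 < ν → 0 < T →
    ∀ (u : ℝ → E3 → E3) (p : ℝ → E3 → ℝ),
    IsMaximalSmoothSolution ν 0 u p T → IsLerayHopfOn T ν 0 (u 0) u → HasRapidSpatialDecay (u 0) →
    ∀ (δ Λ t₁ : ℝ), 0 ≤ δ → δ < 9 - 2 * Real.sqrt 15 → t₁ < T →
      ∃ t ∈ Ioo t₁ T, ∃ x, Λ < ‖u t x‖ ∧
        δ * Real.sqrt ν / ((T - t) * Real.sqrt (T - t)) < ‖ν • Δ (u t) x - gradient (p t) x‖

/-- **Residual** (maximal frame): every Type-I Clay blow-up has a ballistic top with some modulus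
`< 9 − 2√15`.  `TypeIBallisticity ↔ Row_F1` (`typeIBallisticity_iff_rowF1`); DECLARED ≡ row F1. -/
def TypeIBallisticity : Prop :=
  ∀ (ν T : ℝ), 0 < ν → 0 < T →
    ∀ (u : ℝ → E3 → E3) (p : ℝ → E3 → ℝ),
    IsMaximalSmoothSolution ν 0 u p T → IsLerayHopfOn T ν 0 (u 0) u →
    HasRapidSpatialDecay (u 0) → IsTypeIBlowup u T →
    ∃ δ : ℝ, 0 ≤ δ ∧ δ < 9 - 2 * Real.sqrt 15 ∧ HasQuasiSteadyTopAlong ν T δ u u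

/-! ## §2 Real-variable tools (as in LINE 11)

The four tools `QuasiSteadyTop.deltaStar_pos`, `QuasiSteadyTop.kappa_mul_lt_one`, `QuasiSteadyTop.hasDerivAt_inv_sqrt_sub`, `QuasiSteadyTop.norm_le_barrier` are IDENTICAL to
LINE 11's and are used from the tree's F19 port (`ScenarioCensus.QuasiSteadyTop.*`, `ScenarioCensusRowF19Top.lean`). -/

/-! ## §3 Calculus along characteristics -/

section Calculus

variable {ν T : ℝ} {u : ℝ → E3 → E3} {p : ℝ → E3 → ℝ}

/-- `(Ico 0 T) × ℝ³` is a neighbourhood of every interior point `(s, y)`, `0 < s < T`. [folklore] -/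
theorem slab_mem_nhds {s : ℝ} (hs : s ∈ Ioo 0 T) (y : E3) :
    (Ico 0 T ×ˢ (univ : Set E3)) ∈ 𝓝 ((s, y) : ℝ × E3) :=
  prod_mem_nhds (mem_of_superset (Ioo_mem_nhds hs.1 hs.2) Ioo_subset_Ico_self) univ_mem

/-- The velocity is jointly differentiable at interior points. [folklore] -/
theorem hasFDerivAt_uncurry (hsol : IsClassicalNSSolutionOn (Ico 0 T) ν 0 u p) {s : ℝ}
    (hs : s ∈ Ioo 0 T) (y : E3) :
    HasFDerivAt (uncurry u) (fderiv ℝ (uncurry u) (s, y)) (s, y) := by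
  have hsm := hsol.smooth_velocity
  have hd : DifferentiableWithinAt ℝ (uncurry u) (Ico 0 T ×ˢ univ) (s, y) :=
    (hsm (s, y) ⟨⟨hs.1.le, hs.2⟩, mem_univ _⟩).differentiableWithinAt (by simp)
  exact (hd.differentiableAt (slab_mem_nhds hs y)).hasFDerivAt

/-- The joint derivative on `(1, 0)` is the time derivative within `[0,T)`. [folklore] -/
theorem fderiv_uncurry_one_zero (hsol : IsClassicalNSSolutionOn (Ico 0 T) ν 0 u p) {s : ℝ}
    (hs : s ∈ Ioo 0 T) (y : E3) :
    fderiv ℝ (uncurry u) (s, y) ((1 : ℝ), (0 : E3)) = timeDerivWithin (Ico 0 T) u s y := by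
  rw [hsol.smooth_velocity.timeDerivWithin_eq (uniqueDiffOn_Ico 0 T) ⟨hs.1.le, hs.2⟩ y,
    fderivWithin_of_mem_nhds (slab_mem_nhds hs y)]

/-- The joint derivative on `(0, w)` is the spatial derivative. [folklore] -/
theorem fderiv_uncurry_zero (hsol : IsClassicalNSSolutionOn (Ico 0 T) ν 0 u p) {s : ℝ}
    (hs : s ∈ Ioo 0 T) (y w : E3) :
    fderiv ℝ (uncurry u) (s, y) ((0 : ℝ), w) = fderiv ℝ (u s) y w := by
  have hA := hasFDerivAt_uncurry hsol hs y
  have hc : HasFDerivAt (fun z : E3 => ((s, z) : ℝ × E3)) (ContinuousLinearMap.inr ℝ ℝ E3) y :=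
    hasFDerivAt_prodMk_right s y
  have hcomp := hA.comp y hc
  have hfun : (uncurry u ∘ fun z : E3 => ((s, z) : ℝ × E3)) = u s := by
    funext z; rfl
  rw [hfun] at hcomp
  rw [hcomp.fderiv]
  simp

/-- **The convective derivative is the joint derivative on `(1, w)`**:
`D(uncurry u)(s,y)(1,w) = ∂ₜu(s,y) + Du(s)(y) w`. [folklore] -/
theorem fderiv_uncurry_one (hsol : IsClassicalNSSolutionOn (Ico 0 T) ν 0 u p) {s : ℝ}
    (hs : s ∈ Ioo 0 T) (y w : E3) :
    fderiv ℝ (uncurry u) (s, y) ((1 : ℝ), w) =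
      timeDerivWithin (Ico 0 T) u s y + fderiv ℝ (u s) y w := by
  have hsplit : ((1 : ℝ), w) = ((1 : ℝ), (0 : E3)) + ((0 : ℝ), w) := by simp
  rw [hsplit, map_add, fderiv_uncurry_one_zero hsol hs, fderiv_uncurry_zero hsol hs]

/-- **Chain rule along a characteristic**: if `X` has right derivative `w` at `s ∈ (0,T)`, then
`r ↦ u(r, X(r))` has right derivative `∂ₜu(s,X s) + Du(s)(X s) w` at `s`. [folklore] -/
theorem hasDerivWithinAt_along (hsol : IsClassicalNSSolutionOn (Ico 0 T) ν 0 u p) {s : ℝ}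
    (hs : s ∈ Ioo 0 T) {X : ℝ → E3} {w : E3} (hX : HasDerivWithinAt X w (Ici s) s) :
    HasDerivWithinAt (fun r => u r (X r))
      (timeDerivWithin (Ico 0 T) u s (X s) + fderiv ℝ (u s) (X s) w) (Ici s) s := by
  have hA := hasFDerivAt_uncurry hsol hs (X s)
  have hγ : HasDerivWithinAt (fun r : ℝ => ((r, X r) : ℝ × E3)) ((1 : ℝ), w) (Ici s) s :=
    (hasDerivWithinAt_id s _).prodMk hX
  have h := hA.comp_hasDerivWithinAt s hγ
  rw [fderiv_uncurry_one hsol hs] at h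
  exact h

/-- **Sup bound at one interior time** (Tao cover + Sobolev embedding).
[cite: Tao2013Localisation, Cor. 11.1; AdamsFournier2003, Thm. 4.12] -/
theorem exists_sup_bound_at (hν : 0 < ν) (hT : 0 < T)
    (hsol : IsClassicalNSSolutionOn (Ico 0 T) ν 0 u p) (hLH : IsLerayHopfOn T ν 0 (u 0) u)
    (hdec : HasRapidSpatialDecay (u 0)) {t₁ : ℝ} (ht₁ : t₁ ∈ Ioo 0 T) :
    ∃ M : ℝ, 0 ≤ M ∧ ∀ x, ‖u t₁ x‖ ≤ M := by
  obtain ⟨q, hsolc, hH, -, -⟩ := RungReynoldsOne.stub_taoCover hν hT hsol hLH hdec ht₁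
  obtain ⟨M, hM0, hM⟩ := exists_forall_norm_le_of_hasBoundedSobolevNormsOn hsolc hH
  exact ⟨M, hM0, fun x => hM t₁ ⟨ht₁.1.le, le_rfl⟩ x⟩

/-- **Uniform bounds on a closed sub-slab**: for `t < T`, `u` and `Du` are bounded on `[0,t] × ℝ³`
(Tao cover, Sobolev embedding `H² ⊂ C_B` for `u` and `Du`).
[cite: Tao2013Localisation, Cor. 11.1; AdamsFournier2003, Thm. 4.12] -/
theorem exists_bounds_on_slab (hν : 0 < ν) (hT : 0 < T)
    (hsol : IsClassicalNSSolutionOn (Ico 0 T) ν 0 u p) (hLH : IsLerayHopfOn T ν 0 (u 0) u)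
    (hdec : HasRapidSpatialDecay (u 0)) {t : ℝ} (ht : t ∈ Ioo 0 T) :
    ∃ M B : ℝ, 0 ≤ M ∧ 0 ≤ B ∧ (∀ s ∈ Icc 0 t, ∀ y, ‖u s y‖ ≤ M) ∧
      (∀ s ∈ Icc 0 t, ∀ y, ‖fderiv ℝ (u s) y‖ ≤ B) ∧
      (∀ s ∈ Icc 0 t, Differentiable ℝ (u s)) ∧
      ContinuousOn (uncurry u) (Icc 0 t ×ˢ univ) := by
  obtain ⟨q, hsolc, hH, -, -⟩ := RungReynoldsOne.stub_taoCover hν hT hsol hLH hdec ht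
  obtain ⟨M, hM0, hM⟩ := exists_forall_norm_le_of_hasBoundedSobolevNormsOn hsolc hH
  obtain ⟨B, hB0, hB⟩ := exists_forall_norm_fderiv_le_of_hasBoundedSobolevNormsOn
    (fun s hs => (hsolc.contDiff_velocity hs).of_le (by norm_cast)) hH
  exact ⟨M, B, hM0, hB0, hM, hB,
    fun s hs => (hsolc.contDiff_velocity hs).differentiable (by simp),
    hsolc.smooth_velocity.continuousOn⟩

/-- **Galilean observers are admissible**: `b ≡ c` has the explicit characteristics
`X(s) = x + (s − t)c`. [folklore] -/
theorem hasCharacteristics_const (c : E3) (t₁ T : ℝ) : HasCharacteristics (fun _ _ => c) t₁ T := by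
  intro t _ x
  refine ⟨fun s => x + (s - t) • c, by simp, ?_, ?_⟩
  · exact (continuous_const.add ((continuous_id.sub continuous_const).smul continuous_const)).continuousOn
  · intro s _
    have h : HasDerivAt (fun s : ℝ => x + (s - t) • c) ((1 : ℝ) • c) s :=
      (((hasDerivAt_id s).sub_const t).smul_const c).const_add x
    simpa using h.hasDerivWithinAt

/-- **The Lagrangian observer is admissible** (Picard–Lindelöf on closed sub-slabs): for a classical
solution of the Clay frame, `b = u` has backward characteristics from every interior time — on `[0,t]`,
`t < T`, the velocity is bounded and uniformly Lipschitz (Tao cover + Sobolev), so Mathlib's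
`IsPicardLindelof.exists_eq_forall_mem_Icc_hasDerivWithinAt₀` applies on a ball of radius `M(t − t₁)`.
[folklore] -/
theorem hasCharacteristics_velocity (hν : 0 < ν) (hT : 0 < T)
    (hsol : IsClassicalNSSolutionOn (Ico 0 T) ν 0 u p) (hLH : IsLerayHopfOn T ν 0 (u 0) u)
    (hdec : HasRapidSpatialDecay (u 0)) {t₁ : ℝ} (ht₁ : t₁ ∈ Ioo 0 T) : HasCharacteristics u t₁ T := by
  intro t ht x
  have ht0 : 0 < t := ht₁.1.trans ht.1
  obtain ⟨M, B, hM0, hB0, hM, hB, hdiff, hcont⟩ := exists_bounds_on_slab hν hT hsol hLH hdec ⟨ht0, ht.2⟩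
  have ht₁t : t₁ ≤ t := ht.1.le
  set L : ℝ≥0 := ⟨M, hM0⟩ with hL
  set K : ℝ≥0 := ⟨B, hB0⟩ with hK
  set a : ℝ≥0 := ⟨M * (t - t₁), mul_nonneg hM0 (sub_nonneg.2 ht₁t)⟩ with ha
  have t₀mem : t ∈ Icc t₁ t := ⟨ht₁t, le_rfl⟩
  have hPL : IsPicardLindelof (fun s y => u s y) (⟨t, t₀mem⟩ : Icc t₁ t) x a 0 L K := by
    refine ⟨?_, ?_, ?_, ?_⟩
    · intro s hs
      have hs0 : s ∈ Icc 0 t := ⟨ht₁.1.le.trans hs.1, hs.2⟩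
      have hlip : LipschitzWith K (u s) :=
        lipschitzWith_of_nnnorm_fderiv_le (hdiff s hs0) fun y => by
          rw [← NNReal.coe_le_coe, coe_nnnorm]; exact hB s hs0 y
      exact hlip.lipschitzOnWith
    · intro y _
      have hmaps : MapsTo (fun s : ℝ => ((s, y) : ℝ × E3)) (Icc t₁ t) (Icc 0 t ×ˢ univ) :=
        fun s hs => ⟨⟨ht₁.1.le.trans hs.1, hs.2⟩, mem_univ _⟩
      exact hcont.comp (continuousOn_id.prodMk continuousOn_const) hmaps
    · intro s hs y _
      exact hM s ⟨ht₁.1.le.trans hs.1, hs.2⟩ y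
    · simp only [ha, hL, sub_self, max_eq_right (sub_nonneg.2 ht₁t), NNReal.coe_zero, sub_zero]
      exact le_of_eq rfl
  obtain ⟨α, hαt, hα⟩ := hPL.exists_eq_forall_mem_Icc_hasDerivWithinAt₀
  refine ⟨α, by simpa using hαt, fun s hs => (hα s hs).continuousWithinAt, fun s hs => ?_⟩
  exact (hα s ⟨hs.1, hs.2.le⟩).mono_of_mem_nhdsWithin
    (mem_of_superset (Icc_mem_nhdsGE hs.2) (Icc_subset_Icc hs.1 le_rfl))

end Calculus
end Summit.NavierStokesRegularity.NavierStokesRegularity.Theorems.ScenarioCensus.ObserverTop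

end
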